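/-
Copyright: the b2b-balaban T⁴-continuum CRUX team, row NE7b leaf lineage `t4-ne7b-formalise-leaf-02` (gen 136). Project licence.
-/
import Summits.QuantumFields.BalabanUV.T4Continuum.Spine.NE7b.CurlTermsLinear
import Summits.QuantumFields.BalabanUV.T4Continuum.Spine.NE7b.AverageTermsLinear
import Summits.QuantumFields.BalabanUV.T4Continuum.Spine.NE7b.AveragedCurlFormSplit
import Summits.QuantumFields.BalabanUV.T4Continuum.Spine.NE7b.AdmissibleFloorPerturbationTerms
import Literature.MathematicalPhysics.QuantumFieldTheory.Balaban1983to89.B7Prop3GeneralLinearBound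

/-!
# THE TRANSPORT SUB-LETTERS OF THE (pert) BINDER AT k = 1, BOTH FAMILIES: `‖R_{P,c}v − R¹_{P,c}v‖ ≤ 2τ‖v‖` for the curl maps of `…CurlTermsLinear` and
# `‖R_{j,c}v − R¹_{j,c}v‖ ≤ 2τ·|ω|n·‖v‖` for the average maps of `…AverageTermsLinear` (`R¹` = the same maps with all transports `1`, `‖w − 1‖ ≤ τ`), and
# the FULL FORM's (pert) letter `(F¹(x))∕2 − ((2τ)²·4·2(d−1) + (2τ′|ω|n)²·n^{d+1}·n)·Σ_c‖x c‖² ≤ F(x)` on the two-scale torus by `…AdmissibleFloorPerturbationTerms` §3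
# (row NE7b, node U5c; `HOME/b2b-balaban-r1/SectE-interface-proof.md` §5.5 Lemma 5.5's `c₄ε_F`; residual (R2′) family (2), letter (ℓ1); E-side letters by value)

Cell `pub-balaban`, sub-cell `t4`, spine estimate NE7b (`T4WeightBudget.RelWeightBound`; the cell's OWN estimate — NOT PRINTED in [Bałaban 1983–89],
NOT PROVED).  Crux-route work under `Spine/NE7b/` by a row leaf (`t4-ne7b-formalise-leaf-02`, E-side ∕ key-readings ∕ lattice-geometry lineage, gen 136)
under FREEZE (0)'s crux-prover clause; [folklore] letters BY NAME over landed modules; NOTHING of Bałaban's is asserted; no `def` (the map families are carried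
by CTL's ∕ ATL's characterising hypotheses `hR`, the flat twins by the SAME hypotheses at transports `1`); zero `sorry`; no `T4Continuum/Support` leaf.
Imports (hub oleans built): this lineage's `…CurlTermsLinear` (CTL: the `hR` shape; through it TPI `card_plaquettes_through_bond_le`), `…AverageTermsLinear`
(ATL: the `hR` shape; through it TAI `card_fibre_avgBonds_le`, `card_image_avgBonds_le`, `card_terms_through_bond_le`), `…AveragedCurlFormSplit`
(`card_image_four_le`), leaf-05's `…AdmissibleFloorPerturbationTerms` (AFPT §3 `half_flat_le_of_linear_terms_two`), and
`Literature.….B7Prop3GeneralLinearBound` (`norm_conjR_sub_self_le`: `‖R(u)Z − Z‖ ≤ 2ε‖Z‖` for `u ∈ U1`, `‖u − 1‖ ≤ ε` — [B7] (124)–(126) p. 36, PROVED).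

WHY.  AFS2 §3's (pert) letter for the full form — `(F⁰_s Y)∕2 − δ·N′_s Y ≤ F′_s Y` per cube — is produced by AFPT §3 from ONE sub-letter per family,
`‖R_{j,c}v − R⁰_{j,c}v‖ ≤ η‖v‖` on `inc j`, and the counts `(a, b)`.  AFPT's docstring names the instances but no file states them: «op:
`norm_conjR_sub_self_le` with CCTL §1's `‖w − 1‖ ≤ 4τ` ⇒ `η = 8τ` … averages: the same per path transport, weight inside `R`».  `…CoarseCurlTransportLetters`
(ℓ1) is the curl family's letter at the FUNCTIONAL level (`|X_P − X¹_P| ≤ 8τΣ‖B‖`), not AFPT's per-map shape, and the AVERAGE family's letter is typed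
nowhere (g135 `H2-INSTANCE-LEDGER` §3 (ii); `H2-CURRENCY-JUNCTION-g157.md` «◐ (pert) average terms»).  THIS FILE types both per-map sub-letters against
CTL's and ATL's OWN characterising hypotheses (so they compose with `norm_curlMap_le` ∕ `sum_curlMaps_eq` ∕ `norm_avgMap_le` ∕ `sum_avgMaps_eq` by name) and
feeds AFPT §3 with TPI ∕ ACFS ∕ TAI's counts: the (pert) letter of the k = 1 full form BY VALUE in the operator currency, `δ = (2τ)²·4·2(d−1) +
(2τ·|ω|n)²·n^{d+1}·n`, displayed input ONE number `τ` — the distance of the transports to `1` (from the local small gauge (π4), the consumer's).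

WHAT IS PROVED ([folklore]; `𝔸` a normed `ℂ`-algebra with `‖1‖ = 1` as in CTL ∕ ATL; transports in the unit-ball class `U1`):
* §1 (file-local `conjR_one_left`: `R(1)Z = Z`); **`norm_curlMap_sub_flat_le`** — CTL's maps `R` (transports `w`, `hR`) against `R¹` (the same `hR` at `w ≡ 1`),
  PER PLAQUETTE: `‖w_{P,i} − 1‖ ≤ τ` for the three transports of THIS `P` ⊢ `‖R_{P,c}v − R¹_{P,c}v‖ ≤ 2τ‖v‖` for EVERY bond `c` (positions `0` and off-plaquette give `0`)
  — so a localised consumer asks `τ` only on the terms it reads.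
* §2 **`norm_avgMap_sub_flat_le`** — ATL's maps `R` (`ω`, `w`, `hR`) against `R¹` (`hR` at `w ≡ 1`), PER COARSE BOND `j`: `‖w_{j,rt} − 1‖ ≤ τ` on THIS
  term's transports ⊢ ‖R_{j,c}v − R¹_{j,c}v‖ ≤ (2τ·(|ω|·n))‖v‖`
  (a bond is read at most `n` times in a term, TAI `card_fibre_avgBonds_le`).
* §3 **`half_flat_le_full_form`** — AFPT §3 BY NAME: for every bond field `x`,
  `(Σ_P‖Σ_{c∈ι P}R¹_{P,c}(x c)‖² + Σ_j‖Σ_{c∈ιA j}R¹_{j,c}(x c)‖²)∕2 − ((2τ)²·4·2(d−1) + (2τ′·(|ω|n))²·n^{d+1}·n)·Σ_c‖x c‖² ≤ Σ_P‖Σ R_{P,c}(x c)‖² + Σ_j‖Σ R_{j,c}(x c)‖²`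
  — AFS2 §3's `hpert` for the k = 1 full form with `δ` a NUMBER in `(τ, τ′, ω, n, d)`.
* §4 toy: all transports `1` (`τ = 0`): §1 gives `‖R v − R v‖ ≤ 0` (`example`).

NOT HERE (honest): `τ` BY VALUE (the local gauge of (π4) ∕ reading R-V: OWNER ∕ (A3); CCTL §1 gives `4τ₀` for the `V̄₀`-products at k = 1), the
support-restricted variant a per-cube consumer may prefer (terms off `supp Y` contribute `0` on both sides — AFPT's uniform `η` over-counts nothing but asks
`τ` on every term; choose the reference family equal to `R` off the cube's neighbourhood if needed), the Hilbert–Schmidt reading (HSCL `frobenius_norm_conj_sub_le`,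
Q-leaf05-g157-1 UNRULED), (cov), (flat) (FFFT), `k > 1`; anything of Bałaban's beyond [B7] (124)–(126) as PROVED in the tree.  BY-NAME EFFECT ON THE WALL: NONE.
NE7b NOT PRINTED ∕ NOT PROVED; spine PROVED 0∕9; rung (B)+1 on ONE finite T⁴ — NOT infinite volume, NOT the mass gap, NOT Clay.
HONEST DEPENDENCY: continuum YM on T⁴ ⇐ BetaPertH ∧ nine spine estimates (0/9 proved); BetaPertH ⇐ (D1) ∧ (D4) ∧ CAP+tail; G-an2-4 gates asym, D1 and NE2/3/4.
-/

set_option autoImplicit false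

noncomputable section

open Finset
open Literature.MathematicalPhysics.QuantumFieldTheory.Balaban1983to89.B7Prop1Explicit (U1)
open Literature.MathematicalPhysics.QuantumFieldTheory.Balaban1983to89.B7Eq78Linearization (conjR conjR_apply conjR_add conjR_smul_real)
open Literature.MathematicalPhysics.QuantumFieldTheory.Balaban1983to89.B7Prop3GeneralLinearBound (norm_conjR_sub_self_le)
open Summit.QuantumFields.BalabanUV.T4Continuum.NE7b.TorusPlaquetteIncidence (card_plaquettes_through_bond_le)
open Summit.QuantumFields.BalabanUV.T4Continuum.NE7b.AveragedCurlFormSplit (card_image_four_le)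
open Summit.QuantumFields.BalabanUV.T4Continuum.NE7b.TorusAverageIncidence (card_fibre_avgBonds_le card_image_avgBonds_le card_terms_through_bond_le)
open Summit.QuantumFields.BalabanUV.T4Continuum.NE7b.AdmissibleFloorPerturbationTerms (half_flat_le_of_linear_terms_two)

namespace Summit.QuantumFields.BalabanUV.T4Continuum.NE7b.TransportSubLetters

variable {d M : ℕ} (n : ℕ)
variable {𝔸 : Type*} [NormedRing 𝔸] [NormedAlgebra ℂ 𝔸] [NormOneClass 𝔸]

/-! ## §1 The curl maps against their flat twins -/

omit [NormedAlgebra ℂ 𝔸] [NormOneClass 𝔸] in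
/-- `R(1)Z = Z` (file-local, as in `…RotatedSumPairHolonomy`). [folklore] -/
private theorem conjR_one_left (Z : 𝔸) : conjR (1 : 𝔸ˣ) Z = Z := by
  simp only [conjR_apply, Units.val_one, inv_one, one_mul, mul_one]

/-- **THE CURL MAPS' TRANSPORT SUB-LETTER**: CTL's maps `R_{P,c}` (transports `w ∈ U1` with `‖w_{P,i} − 1‖ ≤ τ`) differ from the flat ones `R¹_{P,c}` (the same
characterising hypothesis at `w ≡ 1`) by at most `2τ` in operator size: `‖R_{P,c}v − R¹_{P,c}v‖ ≤ 2τ‖v‖` for every bond `c` (`norm_conjR_sub_self_le` at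
positions `1, 2, 3`; `0` at position `0` and off the plaquette) — AFPT's `hRR₁` with `η₁ = 2τ`. [folklore] -/
theorem norm_curlMap_sub_flat_le
    (ι : (Fin d → ZMod M) × {a : Fin d × Fin d // a.1 < a.2} → Fin 4 → (Fin d → ZMod M) × Fin d)
    (w : (Fin d → ZMod M) × {a : Fin d × Fin d // a.1 < a.2} → Fin 3 → 𝔸ˣ) (hw : ∀ P i, w P i ∈ U1 𝔸)
    (R : (Fin d → ZMod M) × {a : Fin d × Fin d // a.1 < a.2} → (Fin d → ZMod M) × Fin d → 𝔸 →ₗ[ℝ] 𝔸)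
    (hR : ∀ P c, R P c =
        if c = ι P 0 then LinearMap.id
        else if c = ι P 1 then LinearMap.mk ⟨conjR (w P 0), conjR_add (w P 0)⟩ (conjR_smul_real (w P 0))
        else if c = ι P 2 then -LinearMap.mk ⟨conjR (w P 1), conjR_add (w P 1)⟩ (conjR_smul_real (w P 1))
        else if c = ι P 3 then -LinearMap.mk ⟨conjR (w P 2), conjR_add (w P 2)⟩ (conjR_smul_real (w P 2))
        else 0)
    (R1 : (Fin d → ZMod M) × {a : Fin d × Fin d // a.1 < a.2} → (Fin d → ZMod M) × Fin d → 𝔸 →ₗ[ℝ] 𝔸)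
    (hR1 : ∀ P c, R1 P c =
        if c = ι P 0 then LinearMap.id
        else if c = ι P 1 then LinearMap.mk ⟨conjR (1 : 𝔸ˣ), conjR_add 1⟩ (conjR_smul_real 1)
        else if c = ι P 2 then -LinearMap.mk ⟨conjR (1 : 𝔸ˣ), conjR_add 1⟩ (conjR_smul_real 1)
        else if c = ι P 3 then -LinearMap.mk ⟨conjR (1 : 𝔸ˣ), conjR_add 1⟩ (conjR_smul_real 1)
        else 0)
    (P : (Fin d → ZMod M) × {a : Fin d × Fin d // a.1 < a.2}) {τ : ℝ} (hτ : ∀ i, ‖(w P i : 𝔸) - 1‖ ≤ τ)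
    (c : (Fin d → ZMod M) × Fin d) (v : 𝔸) :
    ‖R P c v - R1 P c v‖ ≤ 2 * τ * ‖v‖ := by
  have hτ0 : 0 ≤ 2 * τ * ‖v‖ := mul_nonneg (mul_nonneg zero_le_two ((norm_nonneg _).trans (hτ 0))) (norm_nonneg v)
  rw [hR, hR1]
  split_ifs
  · rw [sub_self, norm_zero]; exact hτ0
  · show ‖conjR (w P 0) v - conjR 1 v‖ ≤ _
    rw [conjR_one_left]
    exact norm_conjR_sub_self_le (hw P 0) (hτ 0) v
  · show ‖-conjR (w P 1) v - -conjR 1 v‖ ≤ _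
    rw [conjR_one_left, neg_sub_neg, norm_sub_rev]
    exact norm_conjR_sub_self_le (hw P 1) (hτ 1) v
  · show ‖-conjR (w P 2) v - -conjR 1 v‖ ≤ _
    rw [conjR_one_left, neg_sub_neg, norm_sub_rev]
    exact norm_conjR_sub_self_le (hw P 2) (hτ 2) v
  · rw [sub_self, norm_zero]; exact hτ0

/-! ## §2 The average maps against their flat twins -/

/-- **THE AVERAGE MAPS' TRANSPORT SUB-LETTER**: ATL's maps `R_{j,c} = ω·Σ_{(r,t): ιA j (r,t) = c} R(w_{j,(r,t)})` (`w ∈ U1`, `‖w − 1‖ ≤ τ`) differ from the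
flat ones `R¹_{j,c}` (`w ≡ 1`) by at most `2τ·|ω|·n`: `‖R_{j,c}v − R¹_{j,c}v‖ ≤ (2τ·(|ω|n))‖v‖` — each of the `≤ n` positions reading the bond `c`
(TAI `card_fibre_avgBonds_le`) contributes `|ω|·2τ‖v‖` (`norm_conjR_sub_self_le`) — AFPT's `hRR₂` with `η₂ = 2τ|ω|n`. [folklore] -/
theorem norm_avgMap_sub_flat_le [NeZero M] (hn : 0 < n)
    (ιA : (Fin d → ZMod M) × Fin d → (Fin d → Fin n) × Fin n → (Fin d → ZMod (n * M)) × Fin d)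
    (hιA : ∀ y κ r t, ιA (y, κ) (r, t) =
      ((fun i => (((y i).val * n + (r i : ℕ) : ℕ) : ZMod (n * M))) + Pi.single κ ((t : ℕ) : ZMod (n * M)), κ))
    (ω : ℝ) (w : (Fin d → ZMod M) × Fin d → (Fin d → Fin n) × Fin n → 𝔸ˣ) (hw : ∀ j rt, w j rt ∈ U1 𝔸)
    (R : (Fin d → ZMod M) × Fin d → (Fin d → ZMod (n * M)) × Fin d → 𝔸 →ₗ[ℝ] 𝔸)
    (hR : ∀ j c, R j c = ω • ∑ rt ∈ Finset.univ.filter (fun rt => ιA j rt = c),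
        LinearMap.mk ⟨conjR (w j rt), conjR_add (w j rt)⟩ (conjR_smul_real (w j rt)))
    (R1 : (Fin d → ZMod M) × Fin d → (Fin d → ZMod (n * M)) × Fin d → 𝔸 →ₗ[ℝ] 𝔸)
    (hR1 : ∀ j c, R1 j c = ω • ∑ _rt ∈ Finset.univ.filter (fun rt => ιA j rt = c),
        LinearMap.mk ⟨conjR (1 : 𝔸ˣ), conjR_add 1⟩ (conjR_smul_real 1))
    (j : (Fin d → ZMod M) × Fin d) {τ : ℝ} (hτ : ∀ rt, ‖(w j rt : 𝔸) - 1‖ ≤ τ)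
    (c : (Fin d → ZMod (n * M)) × Fin d) (v : 𝔸) :
    ‖R j c v - R1 j c v‖ ≤ (2 * τ * (|ω| * n)) * ‖v‖ := by
  classical
  haveI : NeZero n := ⟨hn.ne'⟩
  obtain ⟨y, κ⟩ := j
  have hτ0 : 0 ≤ τ := (norm_nonneg _).trans (hτ 0)
  rw [hR, hR1, LinearMap.smul_apply, LinearMap.smul_apply, ← smul_sub, LinearMap.sum_apply, LinearMap.sum_apply,
    ← Finset.sum_sub_distrib, norm_smul, Real.norm_eq_abs]
  calc |ω| * ‖∑ rt ∈ Finset.univ.filter (fun rt => ιA (y, κ) rt = c),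
          ((LinearMap.mk ⟨conjR (w (y, κ) rt), conjR_add (w (y, κ) rt)⟩ (conjR_smul_real (w (y, κ) rt)) : 𝔸 →ₗ[ℝ] 𝔸) v
            - (LinearMap.mk ⟨conjR (1 : 𝔸ˣ), conjR_add 1⟩ (conjR_smul_real 1) : 𝔸 →ₗ[ℝ] 𝔸) v)‖
      ≤ |ω| * ∑ rt ∈ Finset.univ.filter (fun rt => ιA (y, κ) rt = c), 2 * τ * ‖v‖ := by
        refine mul_le_mul_of_nonneg_left (norm_sum_le_of_le _ fun rt _ => ?_) (abs_nonneg ω)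
        show ‖conjR (w (y, κ) rt) v - conjR 1 v‖ ≤ _
        rw [conjR_one_left]
        exact norm_conjR_sub_self_le (hw (y, κ) rt) (hτ rt) v
    _ = |ω| * (((Finset.univ.filter (fun rt => ιA (y, κ) rt = c)).card : ℝ) * (2 * τ * ‖v‖)) := by
        rw [sum_const, nsmul_eq_mul]
    _ ≤ |ω| * ((n : ℝ) * (2 * τ * ‖v‖)) := by
        refine mul_le_mul_of_nonneg_left (mul_le_mul_of_nonneg_right ?_ (by positivity)) (abs_nonneg ω)
        exact_mod_cast card_fibre_avgBonds_le n ιA hιA hn (y, κ) c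
    _ = 2 * τ * (|ω| * n) * ‖v‖ := by ring

/-! ## §3 The (pert) letter of the k = 1 full form, by value -/

/-- **THE (pert) BINDER OF THE FULL FORM AT k = 1, `δ` A NUMBER** (AFPT §3 `half_flat_le_of_linear_terms_two` fed with §1–§2 and the counts `a₁ = 4`
(ACFS), `b₁ = 2(d−1)` (TPI), `a₂ = n^{d+1}`, `b₂ = n` (TAI)): for every bond field `x` on the two-scale torus,
`(F¹(x))∕2 − ((2τ)²·4·2(d−1) + (2τ′·(|ω|n))²·n^{d+1}·n)·Σ_c‖x c‖² ≤ F(x)`, `F` the covariant full form (CTL's `R`, ATL's `R′`), `F¹` its flat twin. [folklore] -/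
theorem half_flat_le_full_form [NeZero M] [NeZero (n * M)] (hn : 0 < n)
    (ι : (Fin d → ZMod (n * M)) × {a : Fin d × Fin d // a.1 < a.2} → Fin 4 → (Fin d → ZMod (n * M)) × Fin d)
    (hι : ∀ x a, ι (x, a) = ![(x, a.1.1), (x + Pi.single a.1.1 1, a.1.2), (x + Pi.single a.1.2 1, a.1.1), (x, a.1.2)])
    (w : (Fin d → ZMod (n * M)) × {a : Fin d × Fin d // a.1 < a.2} → Fin 3 → 𝔸ˣ) (hw : ∀ P i, w P i ∈ U1 𝔸)
    {τ : ℝ} (hτ : ∀ P i, ‖(w P i : 𝔸) - 1‖ ≤ τ)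
    (R R1 : (Fin d → ZMod (n * M)) × {a : Fin d × Fin d // a.1 < a.2} → (Fin d → ZMod (n * M)) × Fin d → 𝔸 →ₗ[ℝ] 𝔸)
    (hR : ∀ P c, R P c =
        if c = ι P 0 then LinearMap.id
        else if c = ι P 1 then LinearMap.mk ⟨conjR (w P 0), conjR_add (w P 0)⟩ (conjR_smul_real (w P 0))
        else if c = ι P 2 then -LinearMap.mk ⟨conjR (w P 1), conjR_add (w P 1)⟩ (conjR_smul_real (w P 1))
        else if c = ι P 3 then -LinearMap.mk ⟨conjR (w P 2), conjR_add (w P 2)⟩ (conjR_smul_real (w P 2))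
        else 0)
    (hR1 : ∀ P c, R1 P c =
        if c = ι P 0 then LinearMap.id
        else if c = ι P 1 then LinearMap.mk ⟨conjR (1 : 𝔸ˣ), conjR_add 1⟩ (conjR_smul_real 1)
        else if c = ι P 2 then -LinearMap.mk ⟨conjR (1 : 𝔸ˣ), conjR_add 1⟩ (conjR_smul_real 1)
        else if c = ι P 3 then -LinearMap.mk ⟨conjR (1 : 𝔸ˣ), conjR_add 1⟩ (conjR_smul_real 1)
        else 0)
    (ιA : (Fin d → ZMod M) × Fin d → (Fin d → Fin n) × Fin n → (Fin d → ZMod (n * M)) × Fin d)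
    (hιA : ∀ y κ r t, ιA (y, κ) (r, t) =
      ((fun i => (((y i).val * n + (r i : ℕ) : ℕ) : ZMod (n * M))) + Pi.single κ ((t : ℕ) : ZMod (n * M)), κ))
    (ω : ℝ) (w' : (Fin d → ZMod M) × Fin d → (Fin d → Fin n) × Fin n → 𝔸ˣ) (hw' : ∀ j rt, w' j rt ∈ U1 𝔸)
    {τ' : ℝ} (hτ' : ∀ j rt, ‖(w' j rt : 𝔸) - 1‖ ≤ τ')
    (R' R1' : (Fin d → ZMod M) × Fin d → (Fin d → ZMod (n * M)) × Fin d → 𝔸 →ₗ[ℝ] 𝔸)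
    (hR' : ∀ j c, R' j c = ω • ∑ rt ∈ Finset.univ.filter (fun rt => ιA j rt = c),
        LinearMap.mk ⟨conjR (w' j rt), conjR_add (w' j rt)⟩ (conjR_smul_real (w' j rt)))
    (hR1' : ∀ j c, R1' j c = ω • ∑ _rt ∈ Finset.univ.filter (fun rt => ιA j rt = c),
        LinearMap.mk ⟨conjR (1 : 𝔸ˣ), conjR_add 1⟩ (conjR_smul_real 1))
    (x : (Fin d → ZMod (n * M)) × Fin d → 𝔸) :
    (∑ P, ‖∑ c ∈ Finset.univ.image (ι P), R1 P c (x c)‖ ^ 2 + ∑ j, ‖∑ c ∈ Finset.univ.image (ιA j), R1' j c (x c)‖ ^ 2) / 2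
        - ((2 * τ) ^ 2 * (4 : ℕ) * (2 * (d - 1) : ℕ) + (2 * τ' * (|ω| * n)) ^ 2 * (n ^ (d + 1) : ℕ) * (n : ℕ)) * ∑ c, ‖x c‖ ^ 2
      ≤ ∑ P, ‖∑ c ∈ Finset.univ.image (ι P), R P c (x c)‖ ^ 2 + ∑ j, ‖∑ c ∈ Finset.univ.image (ιA j), R' j c (x c)‖ ^ 2 := by
  classical
  exact half_flat_le_of_linear_terms_two (fun P => Finset.univ.image (ι P)) R R1
    (fun P c _ v => norm_curlMap_sub_flat_le ι w hw R hR R1 hR1 P (hτ P) c v)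
    (fun P => card_image_four_le (ι P)) (fun c => card_plaquettes_through_bond_le ι hι c)
    (fun j => Finset.univ.image (ιA j)) R' R1'
    (fun j c _ v => norm_avgMap_sub_flat_le n hn ιA hιA ω w' hw' R' hR' R1' hR1' j (hτ' j) c v)
    (fun j => card_image_avgBonds_le n ιA j) (fun c => card_terms_through_bond_le n ιA hιA hn c) x

/-! ## §4 Toy: flat transports, `τ = 0` -/

/- With all transports `1` and `τ = 0`, §1 reads `‖R_{P,c}v − R_{P,c}v‖ ≤ 2·0·‖v‖` for the SAME family on both sides (`d = 2`, `M = 3`). -/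
example (R : (Fin 2 → ZMod 3) × {a : Fin 2 × Fin 2 // a.1 < a.2} → (Fin 2 → ZMod 3) × Fin 2 → 𝔸 →ₗ[ℝ] 𝔸)
    (hR : ∀ P c, R P c =
        if c = (fun (q : (Fin 2 → ZMod 3) × {a : Fin 2 × Fin 2 // a.1 < a.2}) =>
            ![(q.1, q.2.1.1), (q.1 + Pi.single q.2.1.1 1, q.2.1.2), (q.1 + Pi.single q.2.1.2 1, q.2.1.1), (q.1, q.2.1.2)]) P 0 then LinearMap.id
        else if c = (fun (q : (Fin 2 → ZMod 3) × {a : Fin 2 × Fin 2 // a.1 < a.2}) =>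
            ![(q.1, q.2.1.1), (q.1 + Pi.single q.2.1.1 1, q.2.1.2), (q.1 + Pi.single q.2.1.2 1, q.2.1.1), (q.1, q.2.1.2)]) P 1
          then LinearMap.mk ⟨conjR ((fun _ _ => (1 : 𝔸ˣ)) P 0), conjR_add _⟩ (conjR_smul_real _)
        else if c = (fun (q : (Fin 2 → ZMod 3) × {a : Fin 2 × Fin 2 // a.1 < a.2}) =>
            ![(q.1, q.2.1.1), (q.1 + Pi.single q.2.1.1 1, q.2.1.2), (q.1 + Pi.single q.2.1.2 1, q.2.1.1), (q.1, q.2.1.2)]) P 2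
          then -LinearMap.mk ⟨conjR ((fun _ _ => (1 : 𝔸ˣ)) P 1), conjR_add _⟩ (conjR_smul_real _)
        else if c = (fun (q : (Fin 2 → ZMod 3) × {a : Fin 2 × Fin 2 // a.1 < a.2}) =>
            ![(q.1, q.2.1.1), (q.1 + Pi.single q.2.1.1 1, q.2.1.2), (q.1 + Pi.single q.2.1.2 1, q.2.1.1), (q.1, q.2.1.2)]) P 3
          then -LinearMap.mk ⟨conjR ((fun _ _ => (1 : 𝔸ˣ)) P 2), conjR_add _⟩ (conjR_smul_real _)
        else 0)
    (P : (Fin 2 → ZMod 3) × {a : Fin 2 × Fin 2 // a.1 < a.2}) (c : (Fin 2 → ZMod 3) × Fin 2) (v : 𝔸) :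
    ‖R P c v - R P c v‖ ≤ 2 * 0 * ‖v‖ :=
  norm_curlMap_sub_flat_le _ (fun _ _ => (1 : 𝔸ˣ)) (fun _ _ => Subgroup.one_mem _) R hR R hR P (fun _ => by simp) c v

end Summit.QuantumFields.BalabanUV.T4Continuum.NE7b.TransportSubLetters

end
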